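import Summits.ABC.IUTFork.Repair.RcatGeiger
import HarnessLib

/-!
# REPAIR-CATALOGUE row RC-322 (Geiger 2026), axiom M2 read on the typed Θ-side at a nonarchimedean place

Companion to `Summits/ABC/IUTFork/Repair/RcatGeiger.lean` (same seat: abc-iut-rcat-tst-7, D-0123(C) REPAIR-CATALOGUE; same source
`paper:doi-10-5281-zenodo-20541632`, bib `Geiger2026Cor312Gap`; split off for the 400-line rule). TAKES NO SIDE on [IUTchIII] Cor. 3.12 /
[IUTchIV] Thm. 1.10, on the source, or on any author; the one `def` below is a claim-tagged READING, never a Literature fact; typed ≠ proved;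
refuted-as-typed ≠ refuted-in-print; nothing asserts abc proved or refuted.

CONTENT. Axiom M2 (p.7 l.20–23) says the Θ-side comparison values are `log|Θ_tors(q, ζ_l^j)|`; by the source's Lemma IV.1 (p.4) these have
absolute value `1` at every finite place `v` with `p ∤ l`, `|q|_v < 1` — «trivially negative residuals», §VII.A p.11 l.50–61, Rmk V.6 p.8
l.102–112. Read on the typed Θ-side of a `Cor312.Setting` this is `ThetaSideTrivial P`: every Θ-side packet log-volume vanishes. KERNEL FACTS:
`statement_of_thetaSideTrivial` (where it holds and `−|log(q)| ≤ 0`, the typed Corollary holds OUTRIGHT and contentlessly: `−|log(Θ)| = 0`);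
`candM2_failsAtCountermodel` (it FAILS at the pinned countermodel of record p419720, whose Θ-side carries the honest `j²`-scaled volumes,
`−|log(Θ)| = (5/2)·(−|log(q)|) < 0`); `candM2_false_at_identifiedTwin` (it fails at the identified 2-adic twin, `−|log(Θ)| = −|log(q)| ≠ 0`);
`candM2_qShapeBlind`; `candM2_summary`. HONEST SCOPE: the frozen `Setting` does not tag places as archimedean / nonarchimedean; both models
used are ONE-PLACE NONARCHIMEDEAN toys, i.e. exactly where Lemma IV.1 applies; the archimedean values `log|Θ_tors(q_∞, ζ_l^j)| ≠ 0` of the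
source are not represented here (they are the subject of `RcatGeiger.ArchAvgNegative`). Interface level; no judgement on print or on the source.
[claim: Geiger2026Cor312Gap, status: under-review] [claim: Mochizuki2012, status: disputed]
-/

noncomputable section

open Set

namespace Summit.ABC.IUTFork.Repair.RcatGeiger

open Thm311 Cor312 Cor312.Checks Cor312.IdentifiedNonVacuity Cor312Vol Cor312Vol.NaiveWitness Cor312Vol.PinnedWitness
open Literature.IUT.LogThetaLattice CandMochizuki6Separation CandMochizuki6Vocabulary

/-! ## 1. The reading and its consequences -/

section M2

variable {T : ThetaIndex} {S : Situation T} (P : Setting S)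

/-- **M2 + Lemma IV.1 as a READING of the typed Θ-side** (M2 p.7 l.20–23: «The theta pilot, after normalization by the Tate discriminant
factor (q; q)_∞, produces the comparison values log|Θ_tors(q, ζ_l^j)|»; Lemma IV.1 p.4 and §VII.A p.11 l.50–52: «|Θ_tors(q, ζ_l^j)|_v = 1» at
every finite place `v` with `p ∤ l`, `|q|_v < 1`): the Θ-side packet log-volumes VANISH at every label of `𝔽_l^⋇` and every place of the typed
setting. The frozen `Cor312.Setting` does not tag places as archimedean/nonarchimedean; the models at which the reading is evaluated below are
ONE-PLACE NONARCHIMEDEAN toys (the `p`-adic pinned countermodel and the 2-adic identified twin), i.e. exactly where the source's Lemma IV.1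
applies. HYPOTHESIS / reading; never asserted. [claim: Geiger2026Cor312Gap, status: under-review] -/
@[claim "Geiger2026Cor312Gap" "under-review"] def ThetaSideTrivial : Prop :=
  ∀ (i : Fin T.lstar) (vQ : T.VQ), P.thetaLocal (Setting.labelSucc i) vQ = ((0 : ℝ) : WithTop ℝ)

variable {P}

/-- Under the M2-reading `−|log(Θ)|` is finite. [folklore] -/
theorem thetaFinite_of_thetaSideTrivial (h : ThetaSideTrivial P) : P.ThetaFinite := by
  refine ⟨fun i vQ => by rw [h i vQ]; exact WithTop.coe_ne_top, fun i => ?_⟩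
  have hs : (Function.support fun vQ => (P.thetaLocal (Setting.labelSucc i) vQ).untopD 0) = ∅ := by
    ext vQ
    simp [h i vQ]
  rw [hs]
  exact Set.finite_empty

/-- Under the M2-reading `−|log(Θ)| = 0`. [folklore] -/
theorem negLogTheta_of_thetaSideTrivial (h : ThetaSideTrivial P) : P.negLogTheta = ((0 : ℝ) : WithTop ℝ) := by
  rw [P.negLogTheta_eq_of_thetaFinite (thetaFinite_of_thetaSideTrivial h)]
  congr 1
  have hf : (fun i : Fin T.lstar => ∑ᶠ vQ : T.VQ, (P.thetaLocal (Setting.labelSucc i) vQ).untopD 0) = fun _ => (0 : ℝ) := by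
    funext i
    have hv : (fun vQ => (P.thetaLocal (Setting.labelSucc i) vQ).untopD 0) = fun _ => (0 : ℝ) := by
      funext vQ
      simp [h i vQ]
    rw [hv]
    exact finsum_zero
  rw [hf]
  unfold processionNormalized
  rw [Finset.sum_const_zero, zero_div]

/-- **«TRUE AND CONTENTLESS» — the typed form of the source's Rmk V.6** (p.8 l.102–112: with `|Θ_tors|_v = 1` at all finite places «the
residuals … are negative regardless of v_p(Δ)»): wherever the Θ-side log-volumes vanish and `−|log(q)| ≤ 0`, the typed Corollary holds
outright, for any q-side whatsoever. [folklore] -/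
theorem statement_of_thetaSideTrivial (h : ThetaSideTrivial P) (hq : P.negLogQ ≤ 0) : P.Statement := by
  refine ⟨by rw [negLogTheta_of_thetaSideTrivial h]; exact WithTop.coe_ne_top, ?_⟩
  rw [negLogTheta_of_thetaSideTrivial h, WithTop.coe_le_coe]
  exact hq

/-- The M2-reading FAILS wherever `−|log(Θ)| ≠ 0` — in particular at every model whose Θ-side carries honest (nonzero) volumes. [folklore] -/
theorem not_thetaSideTrivial_of_negLogTheta_ne (h : P.negLogTheta ≠ ((0 : ℝ) : WithTop ℝ)) : ¬ ThetaSideTrivial P :=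
  fun ht => h (negLogTheta_of_thetaSideTrivial ht)

end M2

/-- The M2-reading as a repair candidate on the frozen data (it reads only the Θ-side of `P`). [claim: Geiger2026Cor312Gap, status: under-review] -/
@[claim "Geiger2026Cor312Gap" "under-review"] def candM2 : Cand := fun _ _ P _ _ => ThetaSideTrivial P

/-- T-a at level S, trivially: the M2-reading gives the typed Corollary (contentlessly) under `|log(q)| > 0` alone. [folklore] -/
theorem candM2_sufficientS : SufficientS candM2 :=
  fun _ _ P _ _ _ _ _ hq _ _ h => statement_of_thetaSideTrivial h (le_of_lt (show P.negLogQ < 0 from hq))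

/-- **T-b / k1-type: the M2-reading FAILS at the pinned countermodel of record** (`pinnedSetting p`, p419720: there
`−|log(Θ)| = (5/2)·(−|log(q)|) < 0`), at every prime — the Θ-side of the countermodel carries the honest `j²`-scaled volumes. [folklore] -/
theorem candM2_failsAtCountermodel : FailsAtCountermodel candM2 := fun p _ => by
  apply not_thetaSideTrivial_of_negLogTheta_ne
  rw [pinnedSetting_negLogTheta_eq_mul_negLogQ p]
  intro h
  have h' : (5 : ℝ) / 2 * (pinnedSetting p).negLogQ = 0 := WithTop.coe_injective h
  have hq : (pinnedSetting p).negLogQ < 0 := pinnedSetting_absLogQPos p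
  linarith

/-- … and FAILS at the identified 2-adic twin (`−|log(Θ)| = −|log(q)| = −2·log 2 ≠ 0`), where typed Thm 3.11, the bridge hypotheses, the pins,
S, the Licence and the typed Corollary all hold. [folklore] -/
theorem candM2_false_at_identifiedTwin : ¬ candM2 Checks.toyIndex (sphereFull 2) (idSetting 2) (dualRho 2) (psiDatum 2) := by
  haveI : Fact (Nat.Prime 2) := ⟨Nat.prime_two⟩
  apply not_thetaSideTrivial_of_negLogTheta_ne
  rw [(id_statement 2).2]
  intro h
  have h' : (idSetting 2).negLogQ = 0 := WithTop.coe_injective h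
  have hq : (idSetting 2).negLogQ < 0 := id_absLogQPos 2
  linarith

/-- The M2-reading does not read the q-pilot at all: it is (trivially) shape-blind. [folklore] -/
theorem candM2_qShapeBlind : QShapeBlind candM2 :=
  fun _ _ P _ _ _ g hmem hfin _ _ _ _ _ _ _ _ _ _ =>
    forall₂_congr fun i vQ => by rw [reglue_thetaLocal]

/-- **Summary for the catalogue (RC-322, axiom M2 as a reading of the typed Θ-side)**: level-S sufficient only CONTENTLESSLY (the Corollary with
`−|log(Θ)| = 0`), refuted at the pinned countermodel and at the identified twin (every model of record with nonzero Θ-volumes), shape-blind.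
[folklore] -/
theorem candM2_summary : SufficientS candM2 ∧ FailsAtCountermodel candM2 ∧
    ¬ candM2 Checks.toyIndex (sphereFull 2) (idSetting 2) (dualRho 2) (psiDatum 2) ∧ QShapeBlind candM2 :=
  ⟨candM2_sufficientS, candM2_failsAtCountermodel, candM2_false_at_identifiedTwin, candM2_qShapeBlind⟩

end Summit.ABC.IUTFork.Repair.RcatGeiger

end
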